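import Summits.ValiantsHypothesis.ValiantsHypothesis.Theorems.BarrierLeverChowThinRowsMonomialBasis
import Summits.ValiantsHypothesis.ValiantsHypothesis.Theorems.BarrierLeverChowThinRowsScaleChoice
import Summits.ValiantsHypothesis.ValiantsHypothesis.Theorems.BarrierLeverChowThinRowsSubcubeBasis

/-!
# Route BarrierLever — item `ChowHitsThinRowPartitionMinors` (stmt-ValiantsHypothesis-20195):
# the FIRST-ORDER-ROWS slice for ARBITRARY columns, every height — the whole `s = 1` layer

Helper file (`--supports stmt-ValiantsHypothesis-20195`; cell valiant-natproofs, rung V4, 𝒟-side of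
door (c); prover seat val-np-p7 gen 4).  Closes NO item; imports `…ChowThinRowsMonomialBasis`,
`…ChowThinRowsScaleChoice` (val-np-p7 g4) and prover g10's `…ChowThinRowsSubcubeBasis` (packaging
lemmas `exists_forms_of_card_le`, `det_one_updateRow`); no route file; no definitions.

**Theorem `chowHits_firstOrderRows`.**  For every height `h ≥ 1`, every `r`, all injective rows
`u i ⊆ Fin h` of size `≤ 1` and ALL injective columns `w j ⊆ Fin h` (no structural hypothesis), there
is a product `∏_k ℓ_k` of `h + h` affine forms whose partition minor `det[coeff (E (u i) (w j)) ∏ ℓ]`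
is nonzero — item 20195's conclusion verbatim on its entire first-order layer (rows of size `≤ 1`).
This generalises prover g10's `ChowSubcube.chowHits_firstOrderRows_of_downClosed` (p511832; columns in
a down-closed family of `≤ 2h` sets) and val-np-p7 g3's `ChowThinAffine.chow_hit_thin1_of_affineIndependent`
(p511125; affinely independent columns), and is the kernel form of memo MEMO-CPM-s1-UDC-v6 (UDC for
all `t`): the uniform-design conjecture UDC of memos v2–v5 holds for every affinely spanning column
set, with no twinning / 2-independence hypothesis.

**The witness.**  Let `Δ = {U i}` be a down-closed monomial basis for the columns
(`exists_downClosed_monomialBasis`: `det [U i ⊆ w j] ≠ 0`).  Forms: the SCALED INDICATOR FORMS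
`φ_V = 1 + Σ_a κ_a(V) x_a + σ_V Σ_{c ∈ V} y_c` over `PT = {singletons} ∪ Δ` (`|PT| ≤ 2h`), with
`σ_V = 1` for `|V| ≤ 1` and `σ_V = ε` otherwise, `ε` from `exists_good_scale`; the `x`-coefficients
`κ` are solved (`leaveOneOut_vecMul_injective` ⇒ the leave-one-out vectors on the columns are a basis)
so that the singleton row `{a_i}` of the partition matrix is the indicator of column `i`
(`coeff_single_prodG`); the `∅`-row contributes `b_ε(w i₀) ≠ 0` (`det_one_updateRow`).

WHAT THIS IS NOT: rows of size `2` (the pair layer of item 20195) are not treated; nothing on items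
20172 / 19717 in general, on crux stmt-ValiantsHypothesis-14610, or on `VP` versus `VNP`.
-/

set_option linter.dupNamespace false

namespace Summit.ValiantsHypothesis.ValiantsHypothesis.Theorems.BarrierLever.ChowThinAll

open Finset MvPolynomial
open Summit.ValiantsHypothesis.ValiantsHypothesis.Theorems.BarrierLever.ChowFactor
  (coeff_partitionExpo_mul_affine coeff_partitionExpo_mul_yOnly totalDegree_affine_le)
open Summit.ValiantsHypothesis.ValiantsHypothesis.Theorems.BarrierLever.ProductStateSums
  (castAdd_ne_natAdd partitionExpo_apply_castAdd partitionExpo_apply_natAdd)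
open Summit.ValiantsHypothesis.ValiantsHypothesis.Theorems.BarrierLever.CorankRepair (partitionExpo_eq_iff)

/-- **Thin-row CPM, first-order rows × ARBITRARY columns, every height `h ≥ 1`** (item
`ChowHitsThinRowPartitionMinors`, stmt-ValiantsHypothesis-20195, on its whole layer of rows of size
`≤ 1`): for all injective rows `u i` of size `≤ 1` and all injective columns `w j`, some product of
`h + h` affine forms has a nonsingular partition minor. -/
theorem chowHits_firstOrderRows (h : ℕ) (hh : 1 ≤ h) (r : ℕ) (u w : Fin r → Finset (Fin h))
    (hu : Function.Injective u) (hw : Function.Injective w) (hu1 : ∀ i, (u i).card ≤ 1) :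
    ∃ ℓ : Fin (h + h) → MvPolynomial (Fin (h + h)) ℂ, (∀ k, (ℓ k).totalDegree ≤ 1) ∧
      (Matrix.of fun i j : Fin r => MvPolynomial.coeff
        (∑ a ∈ u i, Finsupp.single (Fin.castAdd h a) 1 +
          ∑ c ∈ w j, Finsupp.single (Fin.natAdd h c) 1) (∏ k, ℓ k)).det ≠ 0 := by
  classical
  -- `r ≤ h + 1`: the rows are distinct subsets of size `≤ 1`
  have hr : r ≤ h + 1 := by
    have hrow : (Finset.univ.image u) ⊆ insert ∅ ((Finset.univ : Finset (Fin h)).image fun a => {a}) := by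
      intro S hS
      obtain ⟨i, -, rfl⟩ := Finset.mem_image.mp hS
      rcases Nat.lt_or_ge (u i).card 1 with h0 | h1
      · exact Finset.mem_insert.mpr (Or.inl (Finset.card_eq_zero.mp (by omega)))
      · obtain ⟨a, ha⟩ := Finset.card_eq_one.mp (le_antisymm (hu1 i) h1)
        exact Finset.mem_insert.mpr (Or.inr (Finset.mem_image.mpr ⟨a, Finset.mem_univ _, ha.symm⟩))
    have e1 : (Finset.univ.image u).card = r := by
      rw [Finset.card_image_of_injective _ hu, Finset.card_univ, Fintype.card_fin]
    have e2 := (Finset.card_le_card hrow).trans (Finset.card_insert_le _ _)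
    have e3 : ((Finset.univ : Finset (Fin h)).image fun a => ({a} : Finset (Fin h))).card ≤ h :=
      Finset.card_image_le.trans (by rw [Finset.card_univ, Fintype.card_fin])
    omega
  -- Step 1: a down-closed monomial basis `U` for the columns
  obtain ⟨U, hUinj, hUdown, hZ⟩ := exists_downClosed_monomialBasis w hw
  -- Step 2: the index family of the forms: all singletons and the `U i`
  set S₁ : Finset (Finset (Fin h)) := (Finset.univ : Finset (Fin h)).image fun c => ({c} : Finset (Fin h))
    with hS₁
  set PT : Finset (Finset (Fin h)) := S₁ ∪ (Finset.univ : Finset (Fin r)).image U with hPT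
  have hsing : ∀ c : Fin h, ({c} : Finset (Fin h)) ∈ PT := fun c =>
    Finset.mem_union_left _ (Finset.mem_image.mpr ⟨c, Finset.mem_univ _, rfl⟩)
  have hUPT : ∀ i, U i ∈ PT := fun i =>
    Finset.mem_union_right _ (Finset.mem_image.mpr ⟨i, Finset.mem_univ _, rfl⟩)
  have himPT : (Finset.univ : Finset (Fin r)).image U ⊆ PT := Finset.subset_union_right
  have hcard : PT.card ≤ h + h := by
    have hS₁card : S₁.card ≤ h :=
      Finset.card_image_le.trans (by rw [Finset.card_univ, Fintype.card_fin])
    have eU : ((Finset.univ : Finset (Fin r)).image U).card = r := by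
      rw [Finset.card_image_of_injective _ hUinj, Finset.card_univ, Fintype.card_fin]
    rw [hPT, ← Finset.union_sdiff_self_eq_union]
    refine (Finset.card_union_le _ _).trans ?_
    have hrest : (((Finset.univ : Finset (Fin r)).image U) \ S₁).card ≤ h := by
      rcases Nat.lt_or_ge r (h + 1) with hlt | hge
      · exact (Finset.card_le_card Finset.sdiff_subset).trans (by rw [eU]; omega)
      · -- `r = h + 1 ≥ 2`: some `U i` is nonempty, so some singleton is a `U i'`
        have hr2 : 2 ≤ r := by omega
        let i₀ : Fin r := ⟨0, by omega⟩
        let i₁ : Fin r := ⟨1, by omega⟩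
        have hne : U i₀ ≠ U i₁ := fun e => by
          have := hUinj e
          simp [i₀, i₁, Fin.ext_iff] at this
        obtain ⟨i, hi⟩ : ∃ i, (U i).Nonempty := by
          by_cases h0 : U i₀ = ∅
          · refine ⟨i₁, Finset.nonempty_iff_ne_empty.mpr fun e => hne (h0.trans e.symm)⟩
          · exact ⟨i₀, Finset.nonempty_iff_ne_empty.mpr h0⟩
        obtain ⟨c, hc⟩ := hi
        obtain ⟨i', hi'⟩ := hUdown i {c} (Finset.singleton_subset_iff.mpr hc)
        have hmem : ({c} : Finset (Fin h)) ∈ ((Finset.univ : Finset (Fin r)).image U) ∩ S₁ :=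
          Finset.mem_inter.mpr ⟨Finset.mem_image.mpr ⟨i', Finset.mem_univ _, hi'⟩,
            Finset.mem_image.mpr ⟨c, Finset.mem_univ _, rfl⟩⟩
        have hpos : 1 ≤ ((((Finset.univ : Finset (Fin r)).image U) ∩ S₁)).card :=
          Finset.card_pos.mpr ⟨_, hmem⟩
        have e := Finset.card_sdiff_add_card_inter ((Finset.univ : Finset (Fin r)).image U) S₁
        omega
    omega
  -- Step 3: the scale `s`
  obtain ⟨s, hs, hBt, hbne⟩ := exists_good_scale U w PT hsing hZ
  -- Step 4: the leave-one-out matrix on the columns is invertible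
  set ℰ : Matrix (Fin r) (Fin r) ℂ := Matrix.of fun i j =>
    coeff (∑ a ∈ (∅ : Finset (Fin h)), Finsupp.single (Fin.castAdd h a) 1 +
        ∑ c ∈ w j, Finsupp.single (Fin.natAdd h c) 1)
      (∏ V ∈ PT.erase (U i), (C 1 + ∑ a, C ((fun (_ : Fin h) (_ : Finset (Fin h)) => (0 : ℂ)) a V) *
          X (Fin.castAdd h a) +
        ∑ c, C ((if V.card ≤ 1 then (1 : ℂ) else s) * (if c ∈ V then 1 else 0)) * X (Fin.natAdd h c)))
    with hℰ
  have hinj : Function.Injective fun v => Matrix.vecMul v ℰ := by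
    intro v v' e
    rw [← sub_eq_zero]
    refine leaveOneOut_vecMul_injective U w hUinj hUdown PT hUPT s hs hBt (v - v') fun j => ?_
    have ej := congr_fun e j
    simp only [Matrix.vecMul, dotProduct, hℰ, Matrix.of_apply] at ej
    simp only [Pi.sub_apply, sub_mul, Finset.sum_sub_distrib]
    rw [sub_eq_zero]
    exact ej
  have hsurj : Function.Surjective fun v => Matrix.vecMul v ℰ :=
    Matrix.vecMul_surjective_iff_isUnit.mpr (Matrix.vecMul_injective_iff_isUnit.mp hinj)
  -- Step 5: the `x`-coefficients: row `{a}` (if `u i = {a}`) becomes the indicator of column `i`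
  choose cvec hcvec using fun i : Fin r => hsurj (fun j => if i = j then (1 : ℂ) else 0)
  obtain ⟨κ, hκ, hκ0⟩ : ∃ κ : Fin h → Finset (Fin h) → ℂ,
      (∀ i a, u i = {a} → ∀ i', κ a (U i') = cvec i i') ∧
      (∀ a V, (¬ ∃ i', U i' = V) → κ a V = 0) := by
    refine ⟨fun a V => if hx : ∃ i, u i = {a} then
      (if hV : ∃ i', U i' = V then cvec (Classical.choose hx) (Classical.choose hV) else 0) else 0, ?_, ?_⟩
    · intro i a hia i'
      have hx : ∃ i, u i = {a} := ⟨i, hia⟩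
      have hV : ∃ i'', U i'' = U i' := ⟨i', rfl⟩
      have hi : Classical.choose hx = i := hu ((Classical.choose_spec hx).trans hia.symm)
      have hi' : Classical.choose hV = i' := hUinj (Classical.choose_spec hV)
      simp only [dif_pos hx, dif_pos hV, hi, hi']
    · intro a V hV
      by_cases hx : ∃ i, u i = {a}
      · simp only [dif_pos hx, dif_neg hV]
      · simp only [dif_neg hx]
  -- Step 6: the forms and their embedding into `Fin (h + h)`
  obtain ⟨ℓ, hℓdeg, hℓprod⟩ := ChowSubcube.exists_forms_of_card_le PT hcard
    (fun V => C 1 + ∑ a, C (κ a V) * X (Fin.castAdd h a) +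
      ∑ c, C ((if V.card ≤ 1 then (1 : ℂ) else s) * (if c ∈ V then 1 else 0)) * X (Fin.natAdd h c))
    (fun V _ => by
      have e : (C 1 + ∑ a, C (κ a V) * X (Fin.castAdd h a) +
          ∑ c, C ((if V.card ≤ 1 then (1 : ℂ) else s) * (if c ∈ V then 1 else 0)) * X (Fin.natAdd h c) :
            MvPolynomial (Fin (h + h)) ℂ) =
          C 1 + ∑ v : Fin (h + h), C (Fin.append (fun a => κ a V)
            (fun c => (if V.card ≤ 1 then (1 : ℂ) else s) * (if c ∈ V then 1 else 0)) v) * X v := by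
        rw [Fin.sum_univ_add]
        simp only [Fin.append_left, Fin.append_right, add_assoc]
      rw [e]
      exact totalDegree_affine_le _ _)
  refine ⟨ℓ, hℓdeg, ?_⟩
  rw [hℓprod]
  -- Step 7: the entries of the partition minor at the singleton rows
  have hentry_single : ∀ i j a, u i = {a} →
      coeff (∑ a' ∈ u i, Finsupp.single (Fin.castAdd h a') 1 +
          ∑ c ∈ w j, Finsupp.single (Fin.natAdd h c) 1)
        (∏ V ∈ PT, (C 1 + ∑ a, C (κ a V) * X (Fin.castAdd h a) +
          ∑ c, C ((if V.card ≤ 1 then (1 : ℂ) else s) * (if c ∈ V then 1 else 0)) * X (Fin.natAdd h c))) =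
        if i = j then 1 else 0 := by
    intro i j a hia
    rw [hia, coeff_single_prodG]
    -- pass to the `x`-free leave-one-out products and restrict the sum to `image U`
    have hterm : ∀ V ∈ PT, κ a V *
        coeff (∑ a' ∈ (∅ : Finset (Fin h)), Finsupp.single (Fin.castAdd h a') 1 +
            ∑ c ∈ w j, Finsupp.single (Fin.natAdd h c) 1)
          (∏ V' ∈ PT.erase V, (C 1 + ∑ a, C (κ a V') * X (Fin.castAdd h a) +
            ∑ c, C ((if V'.card ≤ 1 then (1 : ℂ) else s) * (if c ∈ V' then 1 else 0)) * X (Fin.natAdd h c))) =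
        κ a V * coeff (∑ a' ∈ (∅ : Finset (Fin h)), Finsupp.single (Fin.castAdd h a') 1 +
            ∑ c ∈ w j, Finsupp.single (Fin.natAdd h c) 1)
          (∏ V' ∈ PT.erase V, (C 1 + ∑ a, C ((fun (_ : Fin h) (_ : Finset (Fin h)) => (0 : ℂ)) a V') *
              X (Fin.castAdd h a) +
            ∑ c, C ((if V'.card ≤ 1 then (1 : ℂ) else s) * (if c ∈ V' then 1 else 0)) * X (Fin.natAdd h c))) := by
      intro V _
      rw [coeff_empty_prod_eqG κ (fun _ _ => (0 : ℂ))]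
    rw [Finset.sum_congr rfl hterm]
    rw [← Finset.sum_subset himPT (fun V _ hV => by
      rw [hκ0 a V (fun ⟨i', e⟩ => hV (Finset.mem_image.mpr ⟨i', Finset.mem_univ _, e⟩)), zero_mul])]
    rw [Finset.sum_image (fun i _ i' _ e => hUinj e)]
    have hsum : ∑ i', κ a (U i') *
        coeff (∑ a' ∈ (∅ : Finset (Fin h)), Finsupp.single (Fin.castAdd h a') 1 +
            ∑ c ∈ w j, Finsupp.single (Fin.natAdd h c) 1)
          (∏ V' ∈ PT.erase (U i'), (C 1 + ∑ a, C ((fun (_ : Fin h) (_ : Finset (Fin h)) => (0 : ℂ)) a V') *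
              X (Fin.castAdd h a) +
            ∑ c, C ((if V'.card ≤ 1 then (1 : ℂ) else s) * (if c ∈ V' then 1 else 0)) * X (Fin.natAdd h c))) =
        Matrix.vecMul (cvec i) ℰ j := by
      rw [Matrix.vecMul, dotProduct]
      refine Finset.sum_congr rfl fun i' _ => ?_
      rw [hκ i a hia i', hℰ, Matrix.of_apply]
    rw [hsum]
    exact congr_fun (hcvec i) j
  -- Step 8: the determinant
  set bW : Finset (Fin h) → ℂ := fun W' =>
    coeff (∑ a ∈ (∅ : Finset (Fin h)), Finsupp.single (Fin.castAdd h a) 1 +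
        ∑ c ∈ W', Finsupp.single (Fin.natAdd h c) 1)
      (∏ V ∈ PT, (C 1 + ∑ a, C (κ a V) * X (Fin.castAdd h a) +
        ∑ c, C ((if V.card ≤ 1 then (1 : ℂ) else s) * (if c ∈ V then 1 else 0)) * X (Fin.natAdd h c)))
    with hbW
  by_cases h0 : ∃ i₀, u i₀ = ∅
  · obtain ⟨i₀, hi₀⟩ := h0
    have hdet : (Matrix.of fun i j : Fin r => MvPolynomial.coeff
        (∑ a ∈ u i, Finsupp.single (Fin.castAdd h a) 1 +
          ∑ c ∈ w j, Finsupp.single (Fin.natAdd h c) 1)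
        (∏ V ∈ PT, (C 1 + ∑ a, C (κ a V) * X (Fin.castAdd h a) +
          ∑ c, C ((if V.card ≤ 1 then (1 : ℂ) else s) * (if c ∈ V then 1 else 0)) *
            X (Fin.natAdd h c)))).det = bW (w i₀) := by
      refine ChowSubcube.det_one_updateRow _ i₀ (fun j => bW (w j)) fun i j => ?_
      rw [Matrix.of_apply]
      by_cases hi : i = i₀
      · subst hi
        rw [if_pos rfl, hi₀]
      · rw [if_neg hi]
        have hne : u i ≠ ∅ := fun e => hi (hu (e.trans hi₀.symm))
        have hcard1 : (u i).card = 1 := by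
          have := hu1 i
          have hpos := Finset.card_pos.mpr (Finset.nonempty_iff_ne_empty.mpr hne)
          omega
        obtain ⟨a, ha⟩ := Finset.card_eq_one.mp hcard1
        exact hentry_single i j a ha
    rw [hdet]
    simp only [hbW]
    rw [coeff_empty_prod_eqG κ (fun _ _ => (0 : ℂ))]
    exact hbne i₀
  · have hdet : (Matrix.of fun i j : Fin r => MvPolynomial.coeff
        (∑ a ∈ u i, Finsupp.single (Fin.castAdd h a) 1 +
          ∑ c ∈ w j, Finsupp.single (Fin.natAdd h c) 1)
        (∏ V ∈ PT, (C 1 + ∑ a, C (κ a V) * X (Fin.castAdd h a) +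
          ∑ c, C ((if V.card ≤ 1 then (1 : ℂ) else s) * (if c ∈ V then 1 else 0)) *
            X (Fin.natAdd h c)))) = 1 := by
      ext i j
      rw [Matrix.of_apply, Matrix.one_apply]
      have hne : u i ≠ ∅ := fun e => h0 ⟨i, e⟩
      have hcard1 : (u i).card = 1 := by
        have := hu1 i
        have hpos := Finset.card_pos.mpr (Finset.nonempty_iff_ne_empty.mpr hne)
        omega
      obtain ⟨a, ha⟩ := Finset.card_eq_one.mp hcard1
      exact hentry_single i j a ha
    rw [hdet, Matrix.det_one]
    exact one_ne_zero

end Summit.ValiantsHypothesis.ValiantsHypothesis.Theorems.BarrierLever.ChowThinAll
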